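import Summits.RiemannHypothesis.RiemannHypothesis.Theorems.WeilColumnThetaCut
import Summits.RiemannHypothesis.RiemannHypothesis.Theorems.WeilColumnThetaOddTailNorms
import HarnessLib

/-!
# THETA kernel certificate: the analytic bounds IN THE INTERFACE'S NAMES (`ThetaParams`, p418783) (RH-FREE)

Cell `rh-explicit`, WEIL column, seat handoff-prove-2 gen12 (THETA-ASSIGN v1.0 §3: W3 (cut part), D3, D6, D7 restated over
`P : ThetaParams`).  Glue only — every inequality is an instance of an abstract lemma already in the tree:

* (the CUT facts and D1-hypothesis-free are in `WeilColumnThetaCut`);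
* §2 D3: `∫‖P.TOdd‖² ≤ P.A` and `∫‖(P.TOdd)′‖² ≤ P.B` (`WeilColumnThetaOddTailNorms`), from D1 (`norm_Θ_le`, with the profile's
  continuity now a theorem: `continuous_profile_of_two_le`) and the D2 majorant as a HYPOTHESIS (cc-s2-3's `norm_mul_deriv_Θ_le`);
* (D7 in the interface's names — `≤ P.arch t₀` — is the sibling file `WeilColumnThetaArchBound`);
* (D6 in the interface's names — `primesC + cross` shape, with and without the Rosser–Schoenfeld hypothesis — is the sibling file
  `WeilColumnThetaPrimeBounds`).
Nothing here bears on the truth of RH.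
-/

noncomputable section

set_option linter.dupNamespace false

open Complex Set MeasureTheory Filter
open scoped Real Topology

namespace Summit.RiemannHypothesis.RiemannHypothesis.Theorems.WeilColumn.ThetaMellin

open Literature.NumberTheory.LFunctions

namespace ThetaParams

variable (P : ThetaParams)

/-- **`A`: `∫‖T⁻‖² ≤ P.A`** for an admissible row (D1 + the cut facts; no D2 needed). [THETA-CERT-cc6 §D3] -/
theorem integral_norm_sq_TOdd_le {qn : ℕ} (hP : P.Admissible qn) : ∫ x, ‖P.TOdd x‖ ^ 2 ≤ P.A := by
  have hm1 : 1 ≤ P.m := le_trans (by norm_num) hP.three_le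
  have h := ThetaTail.integral_norm_sq_oddTail_le (Θ := P.Θ) (χ := P.cut) (M := P.M) (m := P.m)
    (P.x₁_neg hP) (rfl : P.u₁ = Real.exp P.x₁) (fun u hu ↦ P.norm_Θ_le' hP hu.1)
    (P.cut_mem_Icc hP.eta_pos hm1) (fun x hx ↦ P.cut_eq_one hP.eta_pos hm1 hx)
  have e : 2 * (P.M ^ 2 * P.u₁ / (2 * P.m + 1)) = P.A := by unfold A; ring
  rw [← e]
  exact h

/-- The derivative of `T⁻` (given the derivative `Θ′` of `Θ` on `(0,∞)` — D2's `hasDerivAt_Θ`). -/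
theorem hasDerivAt_TOdd {qn : ℕ} (hP : P.Admissible qn) {Θ' : ℝ → ℂ} (hΘ' : ∀ u : ℝ, 0 < u → HasDerivAt P.Θ (Θ' u) u)
    (x : ℝ) :
    HasDerivAt P.TOdd
      (((Real.exp (x / 2) : ℂ) * ((1 / 2 : ℂ) * P.Θ (Real.exp x) + (Real.exp x : ℂ) * Θ' (Real.exp x)) *
          (((1 - P.cut x : ℝ)) : ℂ) -
        (Real.exp (x / 2) : ℂ) * P.Θ (Real.exp x) *
          (((bsplineDensity (P.η / (2 * P.m)) (P.m - 1) (x + P.a - P.η / 2)).re : ℝ) : ℂ)) +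
      ((Real.exp (-x / 2) : ℂ) * ((1 / 2 : ℂ) * P.Θ (Real.exp (-x)) + (Real.exp (-x) : ℂ) * Θ' (Real.exp (-x))) *
          (((1 - P.cut (-x) : ℝ)) : ℂ) -
        (Real.exp (-x / 2) : ℂ) * P.Θ (Real.exp (-x)) *
          (((bsplineDensity (P.η / (2 * P.m)) (P.m - 1) (-x + P.a - P.η / 2)).re : ℝ) : ℂ))) x :=
  ThetaTail.hasDerivAt_oddTail (Θ := P.Θ) (χ := P.cut)
    (χ' := fun x ↦ (bsplineDensity (P.η / (2 * P.m)) (P.m - 1) (x + P.a - P.η / 2)).re)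
    hΘ' (fun x ↦ P.hasDerivAt_cut hP.eta_pos (le_trans (by norm_num) hP.three_le) x) x

/-- **`B`: `∫‖(T⁻)′‖² ≤ P.B`** for an admissible row, GIVEN the D2 majorant `‖u·Θ′(u)‖ ≤ M₁·(u/u₁)^{m−1}` on `(0, u₁]`.
[THETA-CERT-cc6 §D3] -/
theorem integral_norm_sq_deriv_TOdd_le {qn : ℕ} (hP : P.Admissible qn) {Θ' : ℝ → ℂ}
    (hΘ' : ∀ u : ℝ, 0 < u → HasDerivAt P.Θ (Θ' u) u)
    (hM₁ : ∀ u ∈ Ioc (0 : ℝ) P.u₁, ‖(u : ℂ) * Θ' u‖ ≤ P.M₁ * (u / P.u₁) ^ (P.m - 1)) :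
    ∫ x, ‖deriv P.TOdd x‖ ^ 2 ≤ P.B := by
  have hm1 : 1 ≤ P.m := le_trans (by norm_num) hP.three_le
  have hm2 : 2 ≤ P.m := le_trans (by norm_num) hP.three_le
  have hderiv := fun x ↦ (P.hasDerivAt_TOdd hP hΘ' x).deriv
  simp only [hderiv]
  have h := ThetaTail.integral_norm_sq_deriv_oddTail_le_thetaCheck (Θ := P.Θ) (Θ' := Θ') (χ := P.cut)
    (χ' := fun x ↦ (bsplineDensity (P.η / (2 * P.m)) (P.m - 1) (x + P.a - P.η / 2)).re)
    (M := P.M) (M₁ := P.M₁) (L := P.m / P.η) (m := P.m) hm1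
    (P.x₁_neg hP) (rfl : P.u₁ = Real.exp P.x₁) (fun u hu ↦ P.norm_Θ_le' hP hu.1) hM₁
    (P.cut_mem_Icc hP.eta_pos hm1) (fun x hx ↦ P.cut_eq_one hP.eta_pos hm1 hx)
    (fun x ↦ P.hasDerivAt_cut hP.eta_pos hm2 x) (fun x ↦ P.abs_cut_deriv_le hP.eta_pos hm2 x)
  have e : 2 * ((1 / 2 + (P.m : ℝ) / P.η) * P.M * Real.sqrt (P.u₁ / (2 * P.m + 1)) +
      P.M₁ * Real.sqrt (P.u₁ / (2 * P.m - 1))) ^ 2 = P.B := by unfold B Bin; ring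
  rw [← e]
  exact h

end ThetaParams

end Summit.RiemannHypothesis.RiemannHypothesis.Theorems.WeilColumn.ThetaMellin

end
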